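import Literature.NumberTheory.PAdicHodge.UnitRootFramePeriods
import Literature.NumberTheory.PAdicHodge.FrobeniusUnitRootPeriod
import Literature.NumberTheory.PAdicHodge.UnramifiedWittPeriodMatrix
import Literature.NumberTheory.PAdicHodge.UnramifiedWittVectors
import Mathlib.RingTheory.Polynomial.GaussLemma
import Mathlib.Algebra.Polynomial.SpecificDegree
import HarnessLib

/-!
# The unit-root period `u ∈ W(k̄) ⊂ A_max` (`φu = αu`), its Frobenius `σ₀u = α^f·u`, and `ρ ≠ χ` because `α` is not a root of unity

Topic `Literature/NumberTheory/PAdicHodge`; namespace `Literature.NumberTheory.PAdicHodge`. THEOREMS ONLY (no definition, no named fact, no instance,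
no `sorry`). Sequel of `UnitRootFramePeriods` (the height-one / ORDINARY frame `απ = p`, `u ∈ A_maxˣ`, `φu = αu`): here the INPUTS of that frame are
constructed from the tree.

* §1 ★ `exists_witt_unitRoot_period` — for `α ∈ ℤ_pˣ` there is a unit `w ∈ W(k̄)` with `φ(w) = w·α` (`WittVector.exists_isUnit_frobenius_eq_mul`,
  Lang's theorem for `W`), whose image `u = ι(w) ∈ A_max` (`wittToAinf`, `ainfToBmaxPlus`) is a unit with **`φu = ι(α)·u`** (`W(k̄) → 𝔸_inf` commutes
  with Frobenius, `WittVector.IsPoly.map`; `W(𝔽_p) = ℤ_p ↦ zpToAinf`, `wittToAinf_padicIntToWitt`).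
* §2 ★ `galBmaxPlus_arithFrob_witt_unitRoot_period` — an arithmetic Frobenius `σ₀ ∈ Γ_F` (`IsAbsArithFrob`, `q_F = p^f`) acts on it by
  **`σ₀u = ι(α^f)·u`** (`𝕎(σ̄₀) = φ^f`, `IsAbsArithFrob.wittGal_eq_iterate_frobenius`).
* §3 ★ `exists_ne_cyclotomicCharacter_of_period` — if `ρ(σ)·σu = χ(σ)·u` for all `σ` (the period property of `UnitRootFramePeriods.galBmaxPlus_unitRoot_mul`)
  and `α^f ≠ 1`, then **`ρ(σ₁) ≠ χ(σ₁)` for some `σ₁`** (else `σ₀u = u = α^f u`).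
* §4 ★ `unitRoot_pow_ne_one` — **`α^n ≠ 1` (`n ≥ 1`) for a root `α ∈ ℤ_p` of `X² − aX + p` with `a ∈ ℤ`, `a² < 4p`** (the Hasse bound): `X² − aX + p` is
  irreducible over `ℚ`, so it would divide `X^n − 1` in `ℚ[X]`, hence in `ℤ[X]` (Gauss), and then `p ∣ 1`. `sq_lt_four_mul_of_sq_le` upgrades Hasse's
  `a² ≤ 4p` (`p` prime is not a square).

BSD context: line `kato_lever` of crux K★ `stmt-BirchSwinnertonDyer-22226`, stub `stub_localFormulaOrdinaryCells` (the (G)-ORDINARY starred cells; `α` = unit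
root of `X² − a_p(E₀)X + p` for the CM fibre `E₀`), memo `…/Cruxes/StarredOptimalManinUnitFiveSeven/Lines/kato-lever-seam-rec-at-cells.md` §17.
Infrastructure only: BSD / K★ are NOT proved by any of this; nothing about elliptic curves is proved here.

## References
* [Katz1981CrystallineDieudonne] N. M. Katz, *Crystalline cohomology, Dieudonné modules, and Jacobi sums* (1981), §5 (unit-root splitting).
* [FontaineAsterisque223III] J.-M. Fontaine, Astérisque 223 (1994), Exp. II §1.2, §1.5; Exp. III §5.
* [SerreLocalFields1979] J.-P. Serre, *Local Fields*, Ch. II §5–§6 (Witt vectors and their Frobenius).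
* [SilvermanAEC2009] J. H. Silverman, *AEC* (2009), Thm. V.1.1, V.2.3.1 (Hasse bound; the roots of `X² − aX + q` are not roots of unity).
-/

noncomputable section

open WittVector Field ValuativeRel Polynomial

namespace Literature.NumberTheory.PAdicHodge

open Literature.NumberTheory.GaloisRepresentations
open Literature.NumberTheory.GaloisRepresentations.IsNonarchimedeanLocalField

section Witt

variable {F : Type} [Field F] [ValuativeRel F] [TopologicalSpace F] [IsNonarchimedeanLocalField F]
  [CharZero F] {p : ℕ} [Fact p.Prime] [Fact (¬ IsUnit (p : maxUnramifiedCompletion F))]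
  [CharP (IsLocalRing.ResidueField (maxUnramifiedCompletion F)) p] [Fact (¬ IsUnit (p : integerC F))]
  [IsAdicComplete (Ideal.span {(p : integerC F)}) (integerC F)]

/-! ## §1 The unit-root period -/

omit [CharZero F] [Fact (¬ IsUnit (p : integerC F))] [IsAdicComplete (Ideal.span {(p : integerC F)}) (integerC F)]
  [Fact (¬ IsUnit (p : maxUnramifiedCompletion F))] in
/-- The image of a `p`-adic unit in `W(k̄)` has non-zero constant coefficient. [cite: SerreLocalFields1979, Ch. II §5 Prop. 10] -/
theorem coeff_zero_padicIntToWitt_ne_zero {α : ℤ_[p]} (hα : IsUnit α) : (padicIntToWitt F p α).coeff 0 ≠ 0 := by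
  have h1 : IsUnit ((padicIntToWitt F p α).coeff 0) := by
    rw [← WittVector.constantCoeff_apply]
    exact hα.map ((WittVector.constantCoeff : WittVector p _ →+* _).comp (padicIntToWitt F p))
  exact h1.ne_zero

omit [IsAdicComplete (Ideal.span {(p : integerC F)}) (integerC F)] in
/-- **`W(k̄) → 𝔸_inf(F)` commutes with the Witt-vector Frobenius** (Frobenius is a polynomial function, `WittVector.IsPoly.map`).
[cite: SerreLocalFields1979, Ch. II §6] [cite: FontaineAsterisque223III, Exp. II §1.2] -/
theorem wittToAinf_frobenius (w : WittVector p (IsLocalRing.ResidueField (maxUnramifiedCompletion F))) :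
    wittToAinf F p (frobenius w) = frobenius (wittToAinf F p w) := by
  unfold wittToAinf
  rw [RingHom.comp_apply, RingHom.comp_apply,
    (WittVector.frobenius_isPoly p).map (residueTiltEquiv F p).toRingHom w,
    (WittVector.frobenius_isPoly p).map (tiltMap p (toCInt₀ F)) (WittVector.map (residueTiltEquiv F p).toRingHom w)]

omit [IsAdicComplete (Ideal.span {(p : integerC F)}) (integerC F)] in
set_option maxHeartbeats 1600000 in
set_option synthInstance.maxHeartbeats 400000 in
/-- ★ **The unit-root period.** For `α ∈ ℤ_pˣ` there is a unit `w ∈ W(k̄)` with `φ(w) = w·α`; its image `u = ι(w) ∈ A_max` is a unit with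
**`φu = ι(α)·u`**. [cite: Katz1981CrystallineDieudonne, §5] [cite: FontaineAsterisque223III, Exp. III §5] -/
theorem exists_witt_unitRoot_period {α : ℤ_[p]} (hα : IsUnit α) :
    ∃ w : WittVector p (IsLocalRing.ResidueField (maxUnramifiedCompletion F)), IsUnit w ∧ frobenius w = w * padicIntToWitt F p α ∧
      IsUnit (ainfToBmaxPlus F p (wittToAinf F p w)) ∧
      frobBmaxPlus F p (ainfToBmaxPlus F p (wittToAinf F p w)) =
        ainfToBmaxPlus F p (zpToAinf α) * ainfToBmaxPlus F p (wittToAinf F p w) := by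
  obtain ⟨w, hw, hφw⟩ := WittVector.exists_isUnit_frobenius_eq_mul p (padicIntToWitt F p α) (coeff_zero_padicIntToWitt_ne_zero hα)
  refine ⟨w, hw, hφw, (hw.map (wittToAinf F p)).map (ainfToBmaxPlus F p), ?_⟩
  rw [frobBmaxPlus_ainfToBmaxPlus, ← wittToAinf_frobenius, hφw, map_mul, wittToAinf_padicIntToWitt, map_mul, mul_comm]

/-! ## §2 An arithmetic Frobenius on the period -/

omit [Fact (¬ IsUnit (p : integerC F))] [IsAdicComplete (Ideal.span {(p : integerC F)}) (integerC F)] [CharZero F]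
  [Fact (¬ IsUnit (p : maxUnramifiedCompletion F))] in
/-- `φ^[n] w = w · α^n` from `φ w = w · α` (`α ∈ ℤ_p` is Frobenius-fixed). [cite: SerreLocalFields1979, Ch. II §6] -/
theorem iterate_frobenius_eq_mul_pow {α : ℤ_[p]} {w : WittVector p (IsLocalRing.ResidueField (maxUnramifiedCompletion F))}
    (hφw : frobenius w = w * padicIntToWitt F p α) (n : ℕ) :
    (⇑(frobenius : WittVector p (IsLocalRing.ResidueField (maxUnramifiedCompletion F)) →+* _))^[n] w = w * padicIntToWitt F p (α ^ n) := by
  induction n with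
  | zero => rw [Function.iterate_zero_apply, pow_zero, map_one, mul_one]
  | succ n ih =>
    have hφα : frobenius (padicIntToWitt F p (α ^ n)) = padicIntToWitt F p (α ^ n) := by
      unfold padicIntToWitt
      rw [RingHom.comp_apply, ← (WittVector.frobenius_isPoly p).map, WittVector.frobenius_zmodp]
    rw [Function.iterate_succ_apply', ih, map_mul, hφw, hφα, pow_succ, map_mul]
    ring

omit [CharZero F] [Fact (¬ IsUnit (p : integerC F))] [IsAdicComplete (Ideal.span {(p : integerC F)}) (integerC F)]
  [Fact (¬ IsUnit (p : maxUnramifiedCompletion F))] in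
/-- `𝕎(σ̄₀) = φ^f` on `W(k̄)` for an arithmetic Frobenius `σ₀` (`q_F = p^f`) — the tree's `IsAbsArithFrob.wittGal_eq_iterate_frobenius`
(`UnramifiedWittFrobenius`, a leaf module), restated here to keep this file's import closure inside the built part of the tree. [cite: FontaineAsterisque223III, Exp. III §5] -/
private theorem wittGal_eq_iterate_frobenius_aux {σ₀ : absoluteGaloisGroup F} (hσ₀ : IsAbsArithFrob σ₀)
    {f : ℕ} (hq : residueFieldCard F = p ^ f) (x : WittVector p (IsLocalRing.ResidueField (maxUnramifiedCompletion F))) :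
    wittGal σ₀ x =
      (⇑(WittVector.frobenius : WittVector p (IsLocalRing.ResidueField (maxUnramifiedCompletion F)) →+*
        WittVector p (IsLocalRing.ResidueField (maxUnramifiedCompletion F))))^[f] x := by
  rw [WittVector.frobenius_eq_map_frobenius]
  refine WittVector.ext fun n => ?_
  rw [coeff_wittGal, IsAbsArithFrob.residueGal_eq_pow hσ₀, hq, ← iterate_frobenius]
  clear hq
  induction f generalizing x with
  | zero => rfl
  | succ f ih =>
    rw [Function.iterate_succ_apply, Function.iterate_succ_apply, ← WittVector.map_coeff, ih]

set_option maxHeartbeats 1600000 in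
set_option synthInstance.maxHeartbeats 400000 in
/-- ★ **`σ₀u = ι(α^f)·u`** for an arithmetic Frobenius `σ₀ ∈ Γ_F` (`q_F = p^f`) and the unit-root period `u = ι(w)`, `φw = w·α`: `𝕎(σ̄₀) = φ^f` on
`W(k̄)`. [cite: FontaineAsterisque223III, Exp. III §5] [cite: SerreLocalFields1979, Ch. II §6] -/
theorem galBmaxPlus_arithFrob_witt_unitRoot_period {σ₀ : absoluteGaloisGroup F} (hσ₀ : IsAbsArithFrob σ₀) {f : ℕ}
    (hq : residueFieldCard F = p ^ f) {α : ℤ_[p]} {w : WittVector p (IsLocalRing.ResidueField (maxUnramifiedCompletion F))}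
    (hφw : frobenius w = w * padicIntToWitt F p α) :
    galBmaxPlus σ₀ (ainfToBmaxPlus F p (wittToAinf F p w)) =
      ainfToBmaxPlus F p (zpToAinf (α ^ f)) * ainfToBmaxPlus F p (wittToAinf F p w) := by
  rw [galBmaxPlus_ainfToBmaxPlus, galAinf_wittToAinf]
  change ainfToBmaxPlus F p (wittToAinf F p (wittGal σ₀ w)) = _
  rw [wittGal_eq_iterate_frobenius_aux hσ₀ hq, iterate_frobenius_eq_mul_pow hφw, map_mul, wittToAinf_padicIntToWitt, map_mul, mul_comm]

/-! ## §3 `ρ ≠ χ` -/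

set_option maxHeartbeats 1600000 in
set_option synthInstance.maxHeartbeats 400000 in
/-- ★ **`ρ ≠ χ` somewhere.** If the unit-root period `u = ι(w)` (`φw = w·α`) satisfies the period property `ρ(σ)·σu = χ(σ)·u` for every `σ ∈ Γ_F`
(`UnitRootFramePeriods.galBmaxPlus_unitRoot_mul`) and `α^f ≠ 1` (`q_F = p^f`), then `ρ(σ₁) ≠ χ(σ₁)` for some `σ₁`: otherwise `σ₀u = u` for an arithmetic
Frobenius `σ₀`, i.e. `ι(α^f − 1)·u = 0` with `u` a unit. [cite: Tate1967, §4] [cite: FontaineAsterisque223III, Exp. III §5] -/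
theorem exists_ne_cyclotomicCharacter_of_period (hF : Function.Surjective (fontaineTheta (integerC F) p))
    {σ₀ : absoluteGaloisGroup F} (hσ₀ : IsAbsArithFrob σ₀) {f : ℕ} (hq : residueFieldCard F = p ^ f) {α : ℤ_[p]} (hαf : α ^ f ≠ 1)
    {w : WittVector p (IsLocalRing.ResidueField (maxUnramifiedCompletion F))} (hw : IsUnit w) (hφw : frobenius w = w * padicIntToWitt F p α)
    (ρ : absoluteGaloisGroup F → ℤ_[p])
    (hper : ∀ σ, ainfToBmaxPlus F p (zpToAinf (ρ σ)) * galBmaxPlus σ (ainfToBmaxPlus F p (wittToAinf F p w)) =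
      ainfToBmaxPlus F p (zpToAinf ((GaloisRep.cyclotomicCharacter F p σ : ℤ_[p]ˣ) : ℤ_[p])) * ainfToBmaxPlus F p (wittToAinf F p w)) :
    ∃ σ₁, ρ σ₁ ≠ ((GaloisRep.cyclotomicCharacter F p σ₁ : ℤ_[p]ˣ) : ℤ_[p]) := by
  by_contra hall'
  have hall : ∀ σ, ρ σ = ((GaloisRep.cyclotomicCharacter F p σ : ℤ_[p]ˣ) : ℤ_[p]) := fun σ => not_ne_iff.1 (not_exists.1 hall' σ)
  obtain ⟨u, hu⟩ : ∃ u, u = ainfToBmaxPlus F p (wittToAinf F p w) := ⟨_, rfl⟩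
  have hunit : IsUnit u := hu ▸ (hw.map (wittToAinf F p)).map (ainfToBmaxPlus F p)
  have hχu : IsUnit (ainfToBmaxPlus F p (zpToAinf ((GaloisRep.cyclotomicCharacter F p σ₀ : ℤ_[p]ˣ) : ℤ_[p]))) :=
    isUnit_ainfToBmaxPlus_zpToAinf (Units.isUnit _)
  have h1 : galBmaxPlus σ₀ u = u := by
    have h := hper σ₀
    rw [hall σ₀, ← hu] at h
    exact hχu.mul_left_cancel h
  rw [hu, galBmaxPlus_arithFrob_witt_unitRoot_period hσ₀ hq hφw, ← hu] at h1
  have h2 : ainfToBmaxPlus F p (zpToAinf (α ^ f - 1)) * u = 0 := by rw [map_sub, map_sub, map_one, map_one, sub_mul, one_mul, h1, sub_self]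
  have h3 : u = 0 := eq_zero_of_zpToAinf_mul_eq_zero hF (sub_ne_zero.2 hαf) h2
  have h4 : IsUnit (thetaBmaxPlus F p u) := hunit.map _
  rw [h3, map_zero] at h4
  exact not_isUnit_zero h4

end Witt

/-! ## §4 `α` is not a root of unity -/

/-- Hasse's `a² ≤ 4p` is strict for a prime `p` (`4p` is not a square). [cite: SilvermanAEC2009, Thm. V.1.1] -/
theorem sq_lt_four_mul_of_sq_le {p : ℕ} (hp : p.Prime) {a : ℤ} (h : a ^ 2 ≤ 4 * p) : a ^ 2 < 4 * p := by
  rcases h.lt_or_eq with h | h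
  · exact h
  exfalso
  -- `a² = 4p`: `2 ∣ a`, `a = 2b`, `b² = p`
  have h2 : (2 : ℤ) ∣ a := by
    have : (2 : ℤ) ∣ a ^ 2 := ⟨2 * p, by rw [h]; ring⟩
    exact Int.prime_two.dvd_of_dvd_pow this
  obtain ⟨b, rfl⟩ := h2
  have hb : b ^ 2 = p := by linarith
  have hb' : (b.natAbs) ^ 2 = p := by
    have := Int.natAbs_pow b 2
    rw [hb, Int.natAbs_natCast] at this
    exact this.symm
  have hm : b.natAbs ∣ p := ⟨b.natAbs, by rw [← hb', sq]⟩
  rcases (Nat.dvd_prime hp).1 hm with h1 | h1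
  · rw [h1, one_pow] at hb'
    exact hp.one_lt.ne' hb'.symm
  · rw [h1, sq] at hb'
    have : p = 1 := by nlinarith [hp.pos]
    exact hp.one_lt.ne' this

/-- ★ **A root of `X² − aX + p` in `ℤ_p` (`a ∈ ℤ`, `a² < 4p`) is not a root of unity**: `α^n ≠ 1` for every `n ≥ 1`. (`X² − aX + p` is irreducible
over `ℚ` — no real root; were `α^n = 1` it would divide `X^n − 1` in `ℚ[X]` (else Bézout gives `1 = 0` at `α`), hence in `ℤ[X]` (Gauss's lemma), and
its constant term `p` would divide `−1`.) In particular the unit root of Frobenius of an ordinary elliptic curve is never a root of unity.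
[cite: SilvermanAEC2009, Thm. V.2.3.1] -/
theorem unitRoot_pow_ne_one {p : ℕ} [hp : Fact p.Prime] {a : ℤ} (ha : a ^ 2 < 4 * p) {α : ℤ_[p]}
    (hα : α ^ 2 - (a : ℤ_[p]) * α + p = 0) {n : ℕ} (hn : 1 ≤ n) : α ^ n ≠ 1 := by
  intro hαn
  -- the integral and rational quadratics
  set fZ : ℤ[X] := C 1 * X ^ 2 + C (-a) * X + C (p : ℤ) with hfZ
  set fQ : ℚ[X] := C 1 * X ^ 2 + C (-(a : ℚ)) * X + C (p : ℚ) with hfQ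
  have hmap : fZ.map (Int.castRingHom ℚ) = fQ := by
    simp [hfZ, hfQ, Polynomial.map_add, Polynomial.map_mul, Polynomial.map_pow]
  have hdegQ : fQ.natDegree = 2 := by rw [hfQ]; exact natDegree_quadratic one_ne_zero
  -- irreducible over `ℚ`: no rational root
  have hirr : Irreducible fQ := by
    refine (irreducible_iff_roots_eq_zero_of_degree_le_three (by omega) (by omega)).2 (Multiset.eq_zero_of_forall_notMem fun r hr => ?_)
    rw [mem_roots (by rintro h; rw [h, natDegree_zero] at hdegQ; exact absurd hdegQ (by norm_num)), IsRoot.def, hfQ] at hr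
    simp only [eval_add, eval_mul, eval_C, eval_pow, eval_X, one_mul, neg_mul] at hr
    have hsq : (2 * r - a) ^ 2 = (a : ℚ) ^ 2 - 4 * p := by linear_combination 4 * hr
    have h4 : ((a : ℚ)) ^ 2 < 4 * p := by exact_mod_cast ha
    nlinarith [sq_nonneg (2 * r - a)]
  -- `α` is a common root of `fQ` and `X^n − 1` in the `ℚ`-algebra `ℚ_p`
  have hroot : aeval (α : ℚ_[p]) fQ = 0 := by
    simp only [hfQ, map_add, map_mul, map_pow, aeval_X, map_one, one_mul, map_neg, map_natCast, map_intCast]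
    have h := congrArg (fun z : ℤ_[p] => (z : ℚ_[p])) hα
    push_cast at h
    linear_combination h
  have hrootn : aeval (α : ℚ_[p]) (X ^ n - 1 : ℚ[X]) = 0 := by
    simp only [map_sub, map_pow, aeval_X, map_one]
    rw [← PadicInt.coe_pow, hαn, PadicInt.coe_one, sub_self]
  -- so `fQ ∣ X^n − 1` in `ℚ[X]`
  have hdvdQ : fQ ∣ (X ^ n - 1 : ℚ[X]) := by
    by_contra hnd
    obtain ⟨u, v, huv⟩ := (hirr.coprime_iff_not_dvd.2 hnd)
    have h := congrArg (aeval (α : ℚ_[p])) huv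
    rw [map_add, map_mul, map_mul, hroot, hrootn, mul_zero, mul_zero, add_zero, map_one] at h
    exact zero_ne_one h
  -- hence in `ℤ[X]` (Gauss)
  have hmonZ : fZ.Monic := by rw [hfZ, Monic, leadingCoeff_quadratic one_ne_zero]
  have hn0 : n ≠ 0 := by omega
  have hdvdZ : fZ ∣ (X ^ n - 1 : ℤ[X]) := by
    rw [IsPrimitive.Int.dvd_iff_map_cast_dvd_map_cast _ _ hmonZ.isPrimitive, hmap]
    simpa using hdvdQ
  -- constant terms: `p ∣ −1`
  obtain ⟨g, hg⟩ := hdvdZ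
  have h0 := congrArg (eval 0) hg
  simp only [eval_sub, eval_pow, eval_X, zero_pow hn0, eval_one, zero_sub, eval_mul, hfZ, eval_add, eval_C, mul_zero,
    one_mul, add_zero] at h0
  have hdvd : (p : ℤ) ∣ 1 := ⟨-g.eval 0, by linear_combination -h0⟩
  have := Int.eq_one_of_dvd_one (by positivity) hdvd
  exact hp.out.one_lt.ne' (by exact_mod_cast this)

end Literature.NumberTheory.PAdicHodge

end
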